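import Summits.Ventures.PercRepro.ProfilePointedCircuitClassesStarSharpC

/-!
# PercRepro — THE SERIES-TWIN REGIME OF `StarNineSharp`: WHEN `f` HAS A SERIES TWIN `z` IN `N ∖ {b, b′}` THE
`b′`-AVOIDING TWO-POINT INEQUALITY HOLDS (p5, gen 53; `proofs/P5-GM1.md` §80 ADD 4 case C and its Sharp layer)

Write `E₇ := E − b − b′` and `𝒲 := BI_4(N)`.  The inequality of `StarNineSharp` at `(e, f)` is
`#{W ∈ 𝒲 : e ∈ W ∌ f, b′ ∉ W} ≤ #{W ∈ 𝒲 : f ∈ W, b′ ∉ W}` (StarSharpP's `inCount_thru_split`, re-proved here as `inCount_thru_split'` so that this module depends on the StarSharpC olean only).  Suppose `{f, z}` is a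
series pair of `R := N ∖ {b, b′}` (`ρ(E₇ − f − z) = 3`, `ρ(E₇ − f) = ρ(E₇ − z) = 4`), `z ∉ {e, b, b′}`, and put
`H := E₇ − f − z` (a plane of `R`).  The demands split into three kinds, each injected into its own kind of target:
* `W` with `(E ∖ W) − b′ ∈ 𝒲` («OFF») ↦ `(E ∖ W) − b′`, a target avoiding `e` of the same kind (`OFF_injection`);
* `W ∋ b, z` with `(E ∖ W) − b′ ∉ 𝒲` («ON») ↦ `W − z + f`, the series swap of `R` (`swap_of_seriesTwin`), a target
  containing `e` and `b`;
* `W ∋ b` avoiding `z`, ON (so `W − b ⊆ H` spans `H` and `ρ(H ∪ {b, b′}) = 4`) ↦ `(H − W) + f + b` when that set is ON,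
  else `W − b + f`: THE CUT LEMMA (`cut_lemma`) — if `(H − W) + z + b + b′` had rank `4` as well, submodularity against
  `H ∪ {b, b′}` (union `E − f`, rank `5`) would force `ρ((H − W) ∪ {b, b′}) ≤ 3` and hence `(H − W) + f` ON — so the
  second image is bi-independent exactly when the first is not ON.
The three target kinds are disjoint (`e ∉ W`, OFF / `e, b ∈ W` / `e ∉ W`, `b ∈ W`, ON or `e ∈ W`, `b ∉ W`), whence
**`inCount_thru_le_of_seriesTwin`** and the instance `starNineSharp_instance_of_series_twin` — the first regime of the
Prop where the modular cut of `b` is used (34,476 of the 279,552 catalogue configurations, §80).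
-/

open scoped Matroid

namespace PercRepro.Cogirth

open Finset ThmH Skew Shadow Profile

variable {α : Type} [DecidableEq α] {N : Matroid α} [N.Finite]

section StarSharpS

variable {b b' : α}

/-- The cell form of the Prop's inequality (a copy of StarSharpP's `inCount_thru_split`, so that this module imports
StarSharpC only): `in_k(e) + thru_k({b′,f}) + thru_k({b′,e,f}) ≤ in_k(f) + thru_k({e,f}) + thru_k({b′,e})` iff
`#{W : e ∈ W ∌ f, b′ ∉ W} ≤ #{W : f ∈ W, b′ ∉ W}`. -/
theorem inCount_thru_split' (k : ℕ) (b' e f : α) :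
    (inCount N k e + thruCount N k {b', f} + thruCount N k {b', e, f} ≤
        inCount N k f + thruCount N k {e, f} + thruCount N k {b', e}) ↔
      ((biIndepSets N k).filter (fun W => (e ∈ W ∧ f ∉ W) ∧ b' ∉ W)).card ≤
        ((biIndepSets N k).filter (fun W => f ∈ W ∧ b' ∉ W)).card := by
  have he := card_filter_eq_sum_four (biIndepSets N k) (fun W => e ∈ W) f b'
  have hf := card_filter_eq_sum_two (biIndepSets N k) (fun W => f ∈ W) b'
  have h1 : thruCount N k {e, f} = ((biIndepSets N k).filter (fun W => (e ∈ W ∧ f ∈ W) ∧ b' ∈ W)).card +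
      ((biIndepSets N k).filter (fun W => (e ∈ W ∧ f ∈ W) ∧ b' ∉ W)).card := by
    unfold thruCount
    have := card_filter_eq_sum_two (biIndepSets N k) (fun W => ({e, f} : Finset α) ⊆ W) b'
    rw [this]
    congr 1 <;> apply congrArg <;> apply filter_congr <;> intro W _ <;>
      simp only [insert_subset_iff, singleton_subset_iff]
  have h2 : thruCount N k {b', e} = ((biIndepSets N k).filter (fun W => (e ∈ W ∧ f ∈ W) ∧ b' ∈ W)).card +
      ((biIndepSets N k).filter (fun W => (e ∈ W ∧ f ∉ W) ∧ b' ∈ W)).card := by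
    unfold thruCount
    have := card_filter_eq_sum_two (biIndepSets N k) (fun W => ({b', e} : Finset α) ⊆ W) f
    rw [this]
    congr 1 <;> apply congrArg <;> apply filter_congr <;> intro W _ <;>
      simp only [insert_subset_iff, singleton_subset_iff] <;> tauto
  have h3 : thruCount N k {b', e, f} = ((biIndepSets N k).filter (fun W => (e ∈ W ∧ f ∈ W) ∧ b' ∈ W)).card := by
    unfold thruCount
    apply congrArg
    apply filter_congr
    intro W _
    simp only [insert_subset_iff, singleton_subset_iff]
    tauto
  have h4 : thruCount N k {b', f} = ((biIndepSets N k).filter (fun W => f ∈ W ∧ b' ∈ W)).card := by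
    unfold thruCount
    apply congrArg
    apply filter_congr
    intro W _
    simp only [insert_subset_iff, singleton_subset_iff]
    tauto
  unfold inCount at he hf ⊢
  rw [h1, h2, h3, h4]
  omega

/-- The complement of `W + b` in `E` is `(E₇ ∖ W) + b′` for `W ⊆ E₇`. -/
theorem sdiff_insert_b_eq {W : Finset α} (hb' : b' ∈ gr N) (hbb' : b ≠ b')
    (hW : W ⊆ ((gr N).erase b).erase b') :
    gr N \ insert b W = insert b' (((gr N).erase b).erase b' \ W) := by
  ext x
  simp only [mem_sdiff, mem_insert, mem_erase, not_or]
  constructor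
  · rintro ⟨hxg, hxb, hxW⟩
    by_cases hxb' : x = b'
    · exact Or.inl hxb'
    · exact Or.inr ⟨⟨hxb', hxb, hxg⟩, hxW⟩
  · rintro (rfl | ⟨⟨hxb', hxb, hxg⟩, hxW⟩)
    · exact ⟨hb', hbb'.symm, fun h' => (mem_erase.1 (hW h')).1 rfl⟩
    · exact ⟨hxg, hxb, hxW⟩

/-- **THE LIFT**: for a `3`-set `Y ⊆ E₇`, `Y + b ∈ BI_4(N)` iff `ρ(Y) = 3` and `ρ(E₇ ∖ Y) = 4`
(`ρ(Y + b) = ρ(Y) + 1`, `ρ((E₇ ∖ Y) + b′) = ρ(E₇ ∖ Y) + 1`). -/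
theorem insert_b_mem_biIndepSets_iff (h : SeriesPair N b b') (hn : (gr N).card = 9) {Y : Finset α}
    (hY : Y ⊆ ((gr N).erase b).erase b') (hY3 : Y.card = 3) :
    insert b Y ∈ biIndepSets N 4 ↔ rk N Y = 3 ∧ rk N (((gr N).erase b).erase b' \ Y) = 4 := by
  have hb : b ∈ gr N := h.1
  have hb' : b' ∈ gr N := h.2.1
  have hbb' : b ≠ b' := h.2.2.1
  have hbY : b ∉ Y := fun h' => (mem_erase.1 (mem_erase.1 (hY h')).2).1 rfl
  have hYg : Y ⊆ gr N := fun x hx => (mem_erase.1 (mem_erase.1 (hY hx)).2).2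
  have hcompl := sdiff_insert_b_eq (N := N) hb' hbb' hY
  have hZ : ((gr N).erase b).erase b' \ Y ⊆ ((gr N).erase b).erase b' := sdiff_subset
  have hb'Z : b' ∉ ((gr N).erase b).erase b' \ Y := fun h' => (mem_erase.1 (mem_sdiff.1 h').1).1 rfl
  have hE7 : (((gr N).erase b).erase b').card = 7 := by
    rw [card_erase_of_mem (mem_erase.2 ⟨hbb'.symm, hb'⟩), card_erase_of_mem hb, hn]
  have hZc : (((gr N).erase b).erase b' \ Y).card = 4 := by
    rw [card_sdiff_of_subset hY, hE7, hY3]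
  rw [mem_biIndepSets, hcompl, rk_insert_left_eq_add_one_of_seriesPair h hY,
    rk_insert_right_eq_add_one_of_seriesPair h hZ, card_insert_of_notMem hbY, card_insert_of_notMem hb'Z, hY3, hZc]
  constructor
  · rintro ⟨-, -, h1, h2⟩
    exact ⟨by omega, by omega⟩
  · rintro ⟨h1, h2⟩
    exact ⟨insert_subset hb hYg, rfl, by omega, by omega⟩

/-- **THE SETS INSIDE `E₇`**: a `4`-set `W ⊆ E₇` is in `BI_4(N)` iff `ρ(W) = 4` and `ρ((E₇ ∖ W) ∪ {b, b′}) = 5`. -/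
theorem mem_biIndepSets_iff_of_subset_E7 (h : SeriesPair N b b') (hn : (gr N).card = 9) {W : Finset α}
    (hW : W ⊆ ((gr N).erase b).erase b') (hW4 : W.card = 4) :
    W ∈ biIndepSets N 4 ↔ rk N W = 4 ∧ rk N (insert b (insert b' (((gr N).erase b).erase b' \ W))) = 5 := by
  have hb : b ∈ gr N := h.1
  have hb' : b' ∈ gr N := h.2.1
  have hbb' : b ≠ b' := h.2.2.1
  have hWg : W ⊆ gr N := fun x hx => (mem_erase.1 (mem_erase.1 (hW hx)).2).2
  have hcompl : gr N \ W = insert b (insert b' (((gr N).erase b).erase b' \ W)) := by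
    ext x
    simp only [mem_sdiff, mem_insert, mem_erase]
    constructor
    · rintro ⟨hxg, hxW⟩
      by_cases hxb : x = b
      · exact Or.inl hxb
      by_cases hxb' : x = b'
      · exact Or.inr (Or.inl hxb')
      exact Or.inr (Or.inr ⟨⟨hxb', hxb, hxg⟩, hxW⟩)
    · rintro (rfl | rfl | ⟨⟨hxb', hxb, hxg⟩, hxW⟩)
      · exact ⟨hb, fun h' => (mem_erase.1 (mem_erase.1 (hW h')).2).1 rfl⟩
      · exact ⟨hb', fun h' => (mem_erase.1 (hW h')).1 rfl⟩
      · exact ⟨hxg, hxW⟩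
  have hcard : (gr N \ W).card = 5 := by rw [card_sdiff_of_subset hWg, hn, hW4]
  rw [mem_biIndepSets, hcard, hW4, hcompl]
  constructor
  · rintro ⟨-, -, h1, h2⟩
    exact ⟨h1, h2⟩
  · rintro ⟨h1, h2⟩
    exact ⟨hWg, rfl, h1, h2⟩

/-! ### The series twin `z` of `f` in `E₇`: rank facts in `N` -/

/-- `f` adds rank to every subset of `H := E₇ − f − z` when `ρ(H) = 3` and `ρ(E₇ − z) = 4`. -/
theorem rk_insert_f_eq_add_one_of_subset_H {f z : α} (hf : f ∈ gr N) (hfz : f ≠ z) (hfb : f ≠ b) (hfb' : f ≠ b')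
    (hH : rk N (((((gr N).erase b).erase b').erase f).erase z) = 3) (hz' : rk N ((((gr N).erase b).erase b').erase z) = 4)
    {S : Finset α} (hS : S ⊆ ((((gr N).erase b).erase b').erase f).erase z) :
    rk N (insert f S) = rk N S + 1 := by
  have hHg : ((((gr N).erase b).erase b').erase f).erase z ⊆ gr N := fun x hx =>
    (mem_erase.1 (mem_erase.1 (mem_erase.1 (mem_erase.1 hx).2).2).2).2
  refine rk_insert_eq_add_one_of_subset hf hS hHg ?_
  have e1 : insert f (((((gr N).erase b).erase b').erase f).erase z) = (((gr N).erase b).erase b').erase z := by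
    rw [erase_right_comm, insert_erase]
    exact mem_erase.2 ⟨hfz, mem_erase.2 ⟨hfb', mem_erase.2 ⟨hfb, hf⟩⟩⟩
  rw [e1, hz', hH]
  omega

/-- `z` adds rank to every subset of `H := E₇ − f − z` when `ρ(H) = 3` and `ρ(E₇ − f) = 4`. -/
theorem rk_insert_z_eq_add_one_of_subset_H {f z : α} (hz : z ∈ gr N) (hfz : f ≠ z) (hzb : z ≠ b) (hzb' : z ≠ b')
    (hH : rk N (((((gr N).erase b).erase b').erase f).erase z) = 3) (hf' : rk N ((((gr N).erase b).erase b').erase f) = 4)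
    {S : Finset α} (hS : S ⊆ ((((gr N).erase b).erase b').erase f).erase z) :
    rk N (insert z S) = rk N S + 1 := by
  have hHg : ((((gr N).erase b).erase b').erase f).erase z ⊆ gr N := fun x hx =>
    (mem_erase.1 (mem_erase.1 (mem_erase.1 (mem_erase.1 hx).2).2).2).2
  refine rk_insert_eq_add_one_of_subset hz hS hHg ?_
  have e1 : insert z (((((gr N).erase b).erase b').erase f).erase z) = (((gr N).erase b).erase b').erase f := by
    rw [insert_erase]
    exact mem_erase.2 ⟨hfz.symm, mem_erase.2 ⟨hzb', mem_erase.2 ⟨hzb, hz⟩⟩⟩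
  rw [e1, hf', hH]
  omega

/-- **THE SERIES SWAP OF `R`, IN `N`-RANKS**: for `Y ⊆ E₇` with `z ∈ Y ∌ f`, `ρ(Y) = #Y` and `ρ(E₇ ∖ Y) = #(E₇ ∖ Y)`,
the set `Y − z + f` has the same rank and so does its complement in `E₇`. -/
theorem swap_rk_of_seriesTwin {f z : α} (hf : f ∈ gr N) (hz : z ∈ gr N) (hfz : f ≠ z) (hfb : f ≠ b) (hfb' : f ≠ b')
    (hzb : z ≠ b) (hzb' : z ≠ b') (hH : rk N (((((gr N).erase b).erase b').erase f).erase z) = 3)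
    (hf' : rk N ((((gr N).erase b).erase b').erase f) = 4) (hz' : rk N ((((gr N).erase b).erase b').erase z) = 4)
    {Y : Finset α} (hY : Y ⊆ ((gr N).erase b).erase b') (hzY : z ∈ Y) (hfY : f ∉ Y) (hYr : rk N Y = Y.card)
    (hYc : rk N (((gr N).erase b).erase b' \ Y) = (((gr N).erase b).erase b' \ Y).card) :
    rk N (insert f (Y.erase z)) = Y.card ∧
      rk N (((gr N).erase b).erase b' \ insert f (Y.erase z)) = (((gr N).erase b).erase b' \ Y).card := by
  have hS : Y.erase z ⊆ ((((gr N).erase b).erase b').erase f).erase z := by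
    intro x hx
    rw [mem_erase] at hx
    exact mem_erase.2 ⟨hx.1, mem_erase.2 ⟨fun h' => hfY (h' ▸ hx.2), hY hx.2⟩⟩
  have hfE : f ∈ ((gr N).erase b).erase b' \ Y := mem_sdiff.2 ⟨mem_erase.2 ⟨hfb', mem_erase.2 ⟨hfb, hf⟩⟩, hfY⟩
  have hT : (((gr N).erase b).erase b' \ Y).erase f ⊆ ((((gr N).erase b).erase b').erase f).erase z := by
    intro x hx
    rw [mem_erase, mem_sdiff] at hx
    exact mem_erase.2 ⟨fun h' => hx.2.2 (h' ▸ hzY), mem_erase.2 ⟨hx.1, hx.2.1⟩⟩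
  constructor
  · rw [rk_insert_f_eq_add_one_of_subset_H hf hfz hfb hfb' hH hz' hS,
      rk_eq_card_of_subset_of_rk_eq_card (erase_subset z Y) hYr, card_erase_of_mem hzY]
    have := card_pos.2 ⟨z, hzY⟩
    omega
  · have e1 : ((gr N).erase b).erase b' \ insert f (Y.erase z) = insert z ((((gr N).erase b).erase b' \ Y).erase f) := by
      ext x
      simp only [mem_sdiff, mem_insert, mem_erase, not_or, not_and]
      constructor
      · rintro ⟨hxg, hxf, hxY⟩
        by_cases hxz : x = z
        · exact Or.inl hxz
        · exact Or.inr ⟨hxf, hxg, hxY hxz⟩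
      · rintro (rfl | ⟨hxf, hxg, hxY⟩)
        · exact ⟨⟨hzb', hzb, hz⟩, hfz.symm, fun h' => absurd rfl h'⟩
        · exact ⟨hxg, hxf, fun _ => hxY⟩
    rw [e1, rk_insert_z_eq_add_one_of_subset_H hz hfz hzb hzb' hH hf' hT,
      rk_eq_card_of_subset_of_rk_eq_card (erase_subset f _) hYc, card_erase_of_mem hfE]
    have := card_pos.2 ⟨f, hfE⟩
    omega

/-- **THE CUT LEMMA**: let `Y ⊆ H := E₇ − f − z` span `H` (`ρ(Y) = ρ(H) = 3`), `P := H ∖ Y` be independent, `Y` be ON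
(`ρ(Y ∪ {b, b′}) = 4`), and suppose `P + z` is ON too (`ρ(P ∪ {z, b, b′}) = 4`).  Then `P + f` is ON:
`ρ(P ∪ {f, b, b′}) = 4`.  (Submodularity of `H ∪ {b, b′}` and `P ∪ {z, b, b′}`, whose union is `E − f` of rank `5`.) -/
theorem cut_lemma (h : SeriesPair N b b') (hcf : ∀ x ∈ gr N, rk N ((gr N).erase x) = 5) {f z : α}
    (hf : f ∈ gr N) (hz : z ∈ gr N) (hfz : f ≠ z) (hfb : f ≠ b) (hfb' : f ≠ b') (hzb : z ≠ b) (hzb' : z ≠ b')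
    (hH : rk N (((((gr N).erase b).erase b').erase f).erase z) = 3)
    (hz' : rk N ((((gr N).erase b).erase b').erase z) = 4)
    {Y : Finset α} (hY : Y ⊆ ((((gr N).erase b).erase b').erase f).erase z) (hYr : rk N Y = 3)
    (hPr : rk N (((((gr N).erase b).erase b').erase f).erase z \ Y) = 2)
    (hYon : rk N (insert b (insert b' Y)) = 4)
    (hPz : rk N (insert b (insert b' (insert z (((((gr N).erase b).erase b').erase f).erase z \ Y)))) = 4) :
    rk N (insert b (insert b' (insert f (((((gr N).erase b).erase b').erase f).erase z \ Y)))) = 4 := by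
  set H := ((((gr N).erase b).erase b').erase f).erase z with hHdef
  set P := H \ Y with hPdef
  have hb : b ∈ gr N := h.1
  have hb' : b' ∈ gr N := h.2.1
  have hbb' : b ≠ b' := h.2.2.1
  have hHg : H ⊆ gr N := fun x hx => (mem_erase.1 (mem_erase.1 (mem_erase.1 (mem_erase.1 hx).2).2).2).2
  have hYg : Y ⊆ gr N := hY.trans hHg
  have hPH : P ⊆ H := sdiff_subset
  have hPE : P ⊆ ((gr N).erase b).erase b' := fun x hx => (mem_erase.1 (mem_erase.1 (hPH hx)).2).2
  -- `H ⊆ cl(Y)`, hence `ρ(H ∪ {b, b′}) = ρ(Y ∪ {b, b′}) = 4`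
  have hHcl : H ⊆ clF N Y := by
    intro x hx
    rw [mem_clF_iff_rk_insert_eq (hHg hx) hYg, hYr]
    have h1 : rk N (insert x Y) ≤ rk N H := rk_mono' (M := N) (insert_subset hx hY)
    have h2 : rk N Y ≤ rk N (insert x Y) := rk_mono' (M := N) (subset_insert x Y)
    omega
  have hHbb' : rk N (insert b (insert b' H)) = 4 := by
    apply le_antisymm
    · have hsub : insert b (insert b' H) ⊆ clF N (insert b (insert b' Y)) := by
        intro x hx
        rw [mem_insert, mem_insert] at hx
        rcases hx with rfl | rfl | hx
        · exact mem_clF_of_mem_of_subset_gr (insert_subset hb (insert_subset hb' hYg)) (mem_insert_self _ _)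
        · exact mem_clF_of_mem_of_subset_gr (insert_subset hb (insert_subset hb' hYg))
            (mem_insert_of_mem (mem_insert_self _ _))
        · exact clF_mono_sub ((subset_insert b' Y).trans (subset_insert b _)) (hHcl hx)
      have := rk_le_rk_of_subset_clF hsub
      omega
    · rw [← hYon]
      exact rk_mono' (M := N) (insert_subset_insert b (insert_subset_insert b' hY))
  -- submodularity against `P ∪ {z, b, b′}`
  have hinter : insert b (insert b' H) ∩ insert b (insert b' (insert z P)) = insert b (insert b' P) := by
    ext x
    simp only [mem_inter, mem_insert]
    constructor
    · rintro ⟨h1, h2⟩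
      rcases h2 with rfl | rfl | rfl | hxP
      · exact Or.inl rfl
      · exact Or.inr (Or.inl rfl)
      · rcases h1 with rfl | rfl | hxH
        · exact absurd rfl hzb
        · exact absurd rfl hzb'
        · exact absurd (mem_erase.1 hxH).1 (fun h' => h' rfl)
      · exact Or.inr (Or.inr hxP)
    · rintro (rfl | rfl | hxP)
      · exact ⟨Or.inl rfl, Or.inl rfl⟩
      · exact ⟨Or.inr (Or.inl rfl), Or.inr (Or.inl rfl)⟩
      · exact ⟨Or.inr (Or.inr (hPH hxP)), Or.inr (Or.inr (Or.inr hxP))⟩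
  have hunion : insert b (insert b' H) ∪ insert b (insert b' (insert z P)) = (gr N).erase f := by
    ext x
    constructor
    · intro hx
      rw [mem_union, mem_insert, mem_insert, mem_insert, mem_insert, mem_insert] at hx
      rw [mem_erase]
      rcases hx with (rfl | rfl | hxH) | (rfl | rfl | rfl | hxP)
      · exact ⟨hfb.symm, hb⟩
      · exact ⟨hfb'.symm, hb'⟩
      · exact ⟨(mem_erase.1 (mem_erase.1 hxH).2).1, hHg hxH⟩
      · exact ⟨hfb.symm, hb⟩
      · exact ⟨hfb'.symm, hb'⟩
      · exact ⟨hfz.symm, hz⟩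
      · exact ⟨(mem_erase.1 (mem_erase.1 (hPH hxP)).2).1, hHg (hPH hxP)⟩
    · intro hx
      rw [mem_erase] at hx
      rw [mem_union, mem_insert, mem_insert, mem_insert, mem_insert, mem_insert]
      by_cases hxb : x = b
      · exact Or.inl (Or.inl hxb)
      by_cases hxb' : x = b'
      · exact Or.inl (Or.inr (Or.inl hxb'))
      by_cases hxz : x = z
      · exact Or.inr (Or.inr (Or.inr (Or.inl hxz)))
      · exact Or.inl (Or.inr (Or.inr (mem_erase.2 ⟨hxz, mem_erase.2 ⟨hx.1, mem_erase.2 ⟨hxb', mem_erase.2 ⟨hxb, hx.2⟩⟩⟩⟩)))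
  have hsub := rk_inter_add_rk_union_le' (M := N) (insert b (insert b' H)) (insert b (insert b' (insert z P)))
  rw [hinter, hunion, hHbb', hPz, hcf f hf] at hsub
  -- `ρ(P ∪ {b, b′}) ≤ 3`, so `ρ(P ∪ {f, b, b′}) ≤ 4`; and `ρ(P ∪ {f, b}) = 4`
  have hfP : rk N (insert f P) = 3 := by
    rw [rk_insert_f_eq_add_one_of_subset_H hf hfz hfb hfb' hH hz' hPH, hPr]
  have hfPb : rk N (insert b (insert f P)) = 4 := by
    rw [rk_insert_left_eq_add_one_of_seriesPair h (insert_subset (mem_erase.2 ⟨hfb', mem_erase.2 ⟨hfb, hf⟩⟩) hPE), hfP]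
  have hup : rk N (insert b (insert b' (insert f P))) ≤ rk N (insert b (insert b' P)) + 1 := by
    have e2 : insert b (insert b' (insert f P)) = insert f (insert b (insert b' P)) := by
      ext x; simp only [mem_insert]; tauto
    rw [e2]
    exact rk_insert_le_add_one hf (insert_subset hb (insert_subset hb' (hPE.trans
      ((erase_subset _ _).trans (erase_subset _ _)))))
  have hlow : rk N (insert b (insert f P)) ≤ rk N (insert b (insert b' (insert f P))) :=
    rk_mono' (M := N) (insert_subset_insert b (subset_insert b' _))
  omega


end StarSharpS

end PercRepro.Cogirth
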